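import Summits.QuantumFields.YangMills.Theorems.PoincareLipschitzLinAvgCurlEll2
import HarnessLib

/-!
# Line «poincare_lipschitz» on crux `HistoryTailL` (stmt-QuantumFields-19936), route crux `BlockLipschitzL` (stmt-QuantumFields-23533), K2 AT DEPTH,
# (R3) INTERIOR REGULARITY — THE SCALE RECURSION OF THE WINDOWED CURL MEANS (`A_{k+1} = L^{−(d+2)}·Σ A_k ∘ shifts`, EXACT) AND THE ONE-LEVEL
# PAIRING DEFECT `|P_{k+1} − P_k| ≤ Σ_Y ω(Y)·|A_k(Y)|` (kernel-mass oscillation × windowed mean)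

Cell `ym3-torus` (YM ladder rung R3 = continuum SU(2) Yang–Mills on the three-torus — a RUNG, NOT the Clay problem: not d = 4, not infinite volume, not a
mass gap); width seat `ym3-torus-px7` gen 4, item (C2) of LOCATE «(R3)-LIN» (19936 evidence #44; LEAD ym-ust-19936-w1 g7 «(C) LOCATE→SIGNATURE welcome»).
LINEAR MODEL ONLY; def-free; imports ✓`PoincareLipschitzLinAvgCurlEll2` (sibling ✓`PoincareLipschitzLinAvgCurlClosedForm`, p682114, has the window ⇄ mean letters); `--supports stmt-QuantumFields-23533`.  Nothing here proves `hStab`,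
(R3), (R4), a stub, `BlockLipschitzL`, `HistoryTailL` or a summit statement.

WHY (LOCATE §3 ∕ (C) plan).  The multiscale pairing that turns «both fields good at every height» into (R3)'s `O((j+1)·L·θBal(K))` telescopes the pairing
`P_k := Σ_{Y ∈ T^{(k)}} K_k(Y)·A_k(Y)` of the level-`k` KERNEL MASSES `K_k` against the WINDOWED MEANS `A_k(Y;μ,ν) := (L^k)^{−2}·curlAt (linAvgIter k X) Y μ ν`
(`|A_k| ≤ 2θ_k L^{−2k}` by a height-`k` window, ✓`abs_mean_curlAt_le_of_window`).  Two exact facts drive it, both proved here on every torus of `Setup`: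
(i) the means form a CHAIN — `A_{k+1}(Y′) = L^{−(d+2)}·Σ_{r′,t,s} A_k(blockSite Y′ r′ + t e_ν + s e_μ)` (one (0.4) step: ✓`AbelianEML.curl_linAvg04` + Stokes); (ii) for
fixed `(t,s)` the map `(Y′, r′) ↦ blockSite Y′ r′ + t e_ν + s e_μ` is a BIJECTION onto `T^{(k)}` (blocks partition, shifts permute) — so the averaging has unit
column sums and moves onto the kernel masses (the abstract skeleton is ✓∕⧗`PoincareLipschitzMultiscalePairing`; this file gives the concrete one-level defect
directly, without inverses of shifts).

* `curlAt_linAvg04_eq_mean` — `curlAt (linAvg04 b) Y′ μ ν = (L^d)⁻¹·Σ_{r′} Σ_{t,s : Fin L} curlAt b (shiftN (shiftN (blockSite Y′ r′) ν t) μ s) μ ν` (any level,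
  any one-form `b`; the idle `Perm × Perm` digits of the (0.4) index set summed out; sibling digit form ✓`SFWGaussianRung.curlAt_linAvg04_eq_sum`).
* ★ `curlAt_linAvgIter_succ_eq_mean` — the same for the iterate: `curlAt (linAvgIter (k+1) a) Y′ = (L^d)⁻¹·Σ_{r′,t,s} curlAt (linAvgIter k a) (…)` — the
  exact scale recursion (a constant fine curl `θ₀` gives `(L^k)²θ₀`: ✓`abs_curlAt_linAvgIter_le_of_fine` is its sup shadow).
* ★ `sum_sum_shift_blockSite` — `Σ_{Y′} Σ_{r′} g (shiftN (shiftN (blockSite Y′ r′) ν t) μ s) = Σ_{Y ∈ T^{(k)}} g Y` (standing range `k+1 ≤ m+K`).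
* `sum_bsite_succ` — kernel masses compose: `Σ_R K(bsite (k+1) Y′ R) = Σ_{r″} Σ_r K(bsite k (blockSite Y′ r″) r)`.
* ★★ `abs_pairing_succ_sub_pairing_le` — THE ONE-LEVEL DEFECT: for level-`k` masses `Kk` and `K_{k+1}(Y′) := Σ_{r″} Kk (blockSite Y′ r″)`, if
  `|Kk (blockSite Y′ r″) − Kk (φ(Y′,r′,t,s))| ≤ ω (φ(Y′,r′,t,s))` for all sub-blocks `r″, r′` and shifts `t, s < L` (oscillation of the level-`k` masses over
  `≤ 2L` level-`k` steps), then `|P_{k+1} − P_k| ≤ Σ_Y ω(Y)·|A_k(Y)|`.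
* ★★ `abs_pairing_zero_le_telescope` — summed over the levels: `|Σ_y K y·curlAt a y μ ν| ≤ Σ_{m<i} Σ_Y ω_m(Y)·|A_m(Y)| + Σ_{Y′} |K_i(Y′)|·|A_i(Y′)|` for ANY
  family of level masses `Km` with `K (m+1) Y′ = Σ_{r″} K m (blockSite Y′ r″)` and oscillation bounds `ω m` as above (`K 0 = K`, `A_0 = curlAt a`).
[folklore] bookkeeping over [Balaban1987RG1] (0.4)/(0.11) p.253 and [Balaban1985Averaging] (9) p.19.
-/

set_option autoImplicit false

noncomputable section

namespace Summit.QuantumFields.YangMills.Theorems.PoincareLipschitzLinAvgCurlMeanRecursion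

open scoped BigOperators
open Literature.MathematicalPhysics.QuantumFieldTheory.Balaban1983to89
open Literature.MathematicalPhysics.QuantumFieldTheory.Balaban1983to89.BlockAveraging (off Idx)
open Literature.MathematicalPhysics.QuantumFieldTheory.Balaban1983to89.BlockAveragingEMLProp2 (shiftN_apply)
open Literature.MathematicalPhysics.QuantumFieldTheory.Balaban1983to89.B10Eq47AxialChi (shiftN shiftN_zero shiftN_succ)
open Summit.QuantumFields.YangMills.Theorems.AbelianEML
  (linAvg04 linAvgIter linAvgIter_succ bsite bsite_succ curlAt rectSum squareSum offPt curl_linAvg04 squareSum_eq_rectSum rectSum_eq_sum_curl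
    offPt_off_eq_blockSite sum_idx_fst card_idx)

variable {P : Params} {j k : ℕ}

/-! ## §1 One (0.4) step: the curl of the linear average is `L^{−d}` times the sum of the fine curls over the translated squares -/

/-- **ONE STEP, MEAN FORM**: `curlAt (linAvg04 b) Y′ μ ν = (L^d)⁻¹·Σ_{r′} Σ_{t,s : Fin L} curlAt b (blockSite Y′ r′ + t e_ν + s e_μ) μ ν`
(✓`curl_linAvg04`: mean over the (0.4) index set of the square fluxes; the fluxes depend on the offset digit only; abelian Stokes ✓`rectSum_eq_sum_curl`).
[cite: Balaban1987RG1, (0.4) p.253; Balaban1985Averaging, (9) p.19] -/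
theorem curlAt_linAvg04_eq_mean (b : PBond P j → ℝ) (y : Site P (j + 1)) (μ ν : Fin P.d) :
    curlAt (linAvg04 b) y μ ν = ((P.L : ℝ) ^ P.d)⁻¹ *
      ∑ r : Fin P.d → Fin P.L, ∑ t : Fin P.L, ∑ s : Fin P.L, curlAt b (shiftN (shiftN (Site.blockSite y r) ν t) μ s) μ ν := by
  have h0 : curlAt (linAvg04 b) y μ ν =
      linAvg04 b ⟨y, μ⟩ + linAvg04 b ⟨y.shift μ, ν⟩ - linAvg04 b ⟨y.shift ν, μ⟩ - linAvg04 b ⟨y, ν⟩ := rfl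
  rw [h0, curl_linAvg04]
  -- the square flux at offset `r` is the double digit sum of fine curls
  set g : (Fin P.d → Fin P.L) → ℝ := fun r =>
    ∑ t : Fin P.L, ∑ s : Fin P.L, curlAt b (shiftN (shiftN (Site.blockSite y r) ν t) μ s) μ ν with hg
  have hsq : ∀ i : Idx P, squareSum b y (off i.1) μ ν = g i.1 := by
    intro i
    rw [squareSum_eq_rectSum, rectSum_eq_sum_curl, offPt_off_eq_blockSite, hg]
    simp only
    rw [Finset.sum_range]
    refine Finset.sum_congr rfl fun t _ => ?_
    rw [Finset.sum_range]
  rw [Finset.sum_congr rfl fun i _ => hsq i, sum_idx_fst, card_idx]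
  have hP : (0 : ℝ) < (Fintype.card (Equiv.Perm (Fin P.d)) * Fintype.card (Equiv.Perm (Fin P.d)) : ℕ) := by
    have : 0 < Fintype.card (Equiv.Perm (Fin P.d)) := Fintype.card_pos
    positivity
  have hL : (0 : ℝ) < ((P.L ^ P.d : ℕ) : ℝ) := by exact_mod_cast pow_pos P.L_pos _
  rw [nsmul_eq_mul]
  push_cast
  field_simp

/-- ★ **THE SCALE RECURSION OF THE CURL OF THE ITERATE**: `curlAt (linAvgIter (k+1) a) Y′ μ ν = (L^d)⁻¹·Σ_{r′} Σ_{t,s : Fin L}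
curlAt (linAvgIter k a) (blockSite Y′ r′ + t e_ν + s e_μ) μ ν`. [cite: Balaban1987RG1, (0.11) p.253] -/
theorem curlAt_linAvgIter_succ_eq_mean (a : PBond P 0 → ℝ) (y : Site P (k + 1)) (μ ν : Fin P.d) :
    curlAt (linAvgIter (k + 1) a) y μ ν = ((P.L : ℝ) ^ P.d)⁻¹ *
      ∑ r : Fin P.d → Fin P.L, ∑ t : Fin P.L, ∑ s : Fin P.L, curlAt (linAvgIter k a) (shiftN (shiftN (Site.blockSite y r) ν t) μ s) μ ν := by
  rw [linAvgIter_succ]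
  exact curlAt_linAvg04_eq_mean (linAvgIter k a) y μ ν

/-- **THE WINDOWED MEANS FORM A CHAIN**: with `A_k(Y) := (L^k)^{−2}·curlAt (linAvgIter k a) Y μ ν`,
`A_{k+1}(Y′) = (L^{d+2})⁻¹·Σ_{r′,t,s} A_k(blockSite Y′ r′ + t e_ν + s e_μ)`. [cite: Balaban1987RG1, (0.11) p.253] -/
theorem mean_succ_eq (a : PBond P 0 → ℝ) (y : Site P (k + 1)) (μ ν : Fin P.d) :
    (((P.L : ℝ) ^ (k + 1)) ^ 2)⁻¹ * curlAt (linAvgIter (k + 1) a) y μ ν = ((P.L : ℝ) ^ (P.d + 2))⁻¹ *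
      ∑ r : Fin P.d → Fin P.L, ∑ t : Fin P.L, ∑ s : Fin P.L,
        (((P.L : ℝ) ^ k) ^ 2)⁻¹ * curlAt (linAvgIter k a) (shiftN (shiftN (Site.blockSite y r) ν t) μ s) μ ν := by
  rw [curlAt_linAvgIter_succ_eq_mean]
  have hL : (P.L : ℝ) ≠ 0 := by exact_mod_cast P.L_pos.ne'
  simp_rw [← Finset.mul_sum]
  rw [pow_add, pow_succ]
  field_simp
  ring

/-! ## §2 Reindexing: sub-block sites, shifted, run over the fine torus exactly once -/

/-- Straight shifts are injective (hence bijective) on the torus. [folklore] -/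
theorem shiftN_bijective (μ : Fin P.d) (n : ℕ) : Function.Bijective fun x : Site P j => shiftN x μ n := by
  have hinj : Function.Injective fun x : Site P j => shiftN x μ n := by
    intro x x' h
    funext ι
    have h1 := congrArg (fun z : Site P j => z ι) h
    simp only [shiftN_apply] at h1
    exact add_right_cancel h1
  exact Finite.injective_iff_bijective.mp hinj

/-- ★ **BLOCKS PARTITION, SHIFTS PERMUTE**: for fixed shifts `t, s`, summing `g` over the shifted sub-block sites of all level-`(k+1)` sites is summing `g`
over `T^{(k)}` (standing range). [cite: Balaban1987RG1, (0.3) p.252] -/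
theorem sum_sum_shift_blockSite (hk : k + 1 ≤ P.m + P.K) (μ ν : Fin P.d) (t s : ℕ) (g : Site P k → ℝ) :
    ∑ y : Site P (k + 1), ∑ r : Fin P.d → Fin P.L, g (shiftN (shiftN (Site.blockSite y r) ν t) μ s) = ∑ x : Site P k, g x := by
  classical
  -- shifts permute `T^{(k)}`
  have hshift : ∑ x : Site P k, g (shiftN (shiftN x ν t) μ s) = ∑ x : Site P k, g x := by
    have h1 := Function.Bijective.sum_comp (shiftN_bijective (j := k) ν t) (fun x => g (shiftN x μ s))
    have h2 := Function.Bijective.sum_comp (shiftN_bijective (j := k) μ s) g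
    exact h1.trans h2
  rw [← hshift]
  -- blocks partition `T^{(k)}`
  set G : Site P k → ℝ := fun x => g (shiftN (shiftN x ν t) μ s) with hG
  have hblock : ∀ y : Site P (k + 1), ∑ r : Fin P.d → Fin P.L, G (Site.blockSite y r) = ∑ x ∈ block y, G x := by
    intro y
    have hmem : ∀ x, x ∈ block y ↔ blockOf x = y := fun x => by simp [block]
    rw [Finset.sum_subtype (block y) hmem (fun x => G x)]
    exact Fintype.sum_equiv (Site.blockEquiv hk y).symm (fun r => G (Site.blockSite y r)) (fun x => G x.1) fun r => rfl
  show ∑ y : Site P (k + 1), ∑ r : Fin P.d → Fin P.L, G (Site.blockSite y r) = ∑ x : Site P k, G x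
  simp_rw [hblock]
  simp only [block]
  exact Finset.sum_fiberwise Finset.univ blockOf G

/-- **KERNEL MASSES COMPOSE**: a sum over the offsets of a level-`(k+1)` block is the sum over its `L^d` sub-blocks of the sums over their offsets
(`R = r″·L^k + r`, ✓`AbelianEML.bsite_succ`; standing range). [cite: Balaban1987RG1, (0.3) p.252] -/
theorem sum_bsite_succ (hk : k + 1 ≤ P.m + P.K) (y : Site P (k + 1)) (K : Site P 0 → ℝ) :
    ∑ R : Fin P.d → Fin (P.L ^ (k + 1)), K (bsite (k + 1) y R) =
      ∑ r'' : Fin P.d → Fin P.L, ∑ r : Fin P.d → Fin (P.L ^ k), K (bsite k (Site.blockSite y r'') r) := by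
  let eT : Fin P.L × Fin (P.L ^ k) ≃ Fin (P.L ^ (k + 1)) := finProdFinEquiv.trans (finCongr (Nat.mul_comm _ _))
  let eR : (Fin P.d → Fin P.L) × (Fin P.d → Fin (P.L ^ k)) ≃ (Fin P.d → Fin (P.L ^ (k + 1))) :=
    (Equiv.arrowProdEquivProdArrow _ _ _).symm.trans (Equiv.arrowCongr (Equiv.refl _) eT)
  rw [← Equiv.sum_comp eR, Fintype.sum_prod_type]
  refine Finset.sum_congr rfl fun r'' _ => Finset.sum_congr rfl fun r _ => ?_
  rw [bsite_succ hk]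
  rfl

/-! ## §3 The one-level pairing defect and its telescope -/

/-- ★★ **THE ONE-LEVEL PAIRING DEFECT.**  Level-`k` masses `Kk`, level-`(k+1)` masses `Σ_{r″} Kk (blockSite Y′ r″)`, windowed means
`A_k(Y) = (L^k)^{−2}·curlAt (linAvgIter k a) Y μ ν`; if `|Kk (blockSite Y′ r″) − Kk (φ)| ≤ ω φ` for `φ = blockSite Y′ r′ + t e_ν + s e_μ`, all `r″, r′, t, s`
(mass oscillation over `≤ 2L` level-`k` steps), then `|Σ_{Y′} K_{k+1}(Y′)·A_{k+1}(Y′) − Σ_Y Kk(Y)·A_k(Y)| ≤ Σ_Y ω(Y)·|A_k(Y)|` (standing range). [folklore] -/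
theorem abs_pairing_succ_sub_pairing_le (hk : k + 1 ≤ P.m + P.K) (a : PBond P 0 → ℝ) (μ ν : Fin P.d) (Kk ω : Site P k → ℝ)
    (hω : ∀ (y : Site P (k + 1)) (r' r'' : Fin P.d → Fin P.L) (t s : Fin P.L),
      |Kk (Site.blockSite y r'') - Kk (shiftN (shiftN (Site.blockSite y r') ν t) μ s)| ≤ ω (shiftN (shiftN (Site.blockSite y r') ν t) μ s)) :
    |∑ y : Site P (k + 1), (∑ r'' : Fin P.d → Fin P.L, Kk (Site.blockSite y r'')) *
          ((((P.L : ℝ) ^ (k + 1)) ^ 2)⁻¹ * curlAt (linAvgIter (k + 1) a) y μ ν) -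
        ∑ x : Site P k, Kk x * ((((P.L : ℝ) ^ k) ^ 2)⁻¹ * curlAt (linAvgIter k a) x μ ν)| ≤
      ∑ x : Site P k, ω x * |(((P.L : ℝ) ^ k) ^ 2)⁻¹ * curlAt (linAvgIter k a) x μ ν| := by
  classical
  -- reordering a fourfold sum `Σ_y Σ_r' Σ_t Σ_s = Σ_t Σ_s Σ_y Σ_r'` (inlined; cf. `TwistedSlab.sum_comm_four`)
  have sum_four_comm : ∀ F : Site P (k + 1) → (Fin P.d → Fin P.L) → Fin P.L → Fin P.L → ℝ,
      ∑ a, ∑ b, ∑ c, ∑ d, F a b c d = ∑ c, ∑ d, ∑ a, ∑ b, F a b c d := by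
    intro F
    calc ∑ a, ∑ b, ∑ c, ∑ d, F a b c d = ∑ a, ∑ c, ∑ b, ∑ d, F a b c d :=
          Finset.sum_congr rfl fun a _ => Finset.sum_comm
      _ = ∑ c, ∑ a, ∑ b, ∑ d, F a b c d := Finset.sum_comm
      _ = ∑ c, ∑ a, ∑ d, ∑ b, F a b c d :=
          Finset.sum_congr rfl fun c _ => Finset.sum_congr rfl fun a _ => Finset.sum_comm
      _ = ∑ c, ∑ d, ∑ a, ∑ b, F a b c d := Finset.sum_congr rfl fun c _ => Finset.sum_comm
  set A : Site P k → ℝ := fun x => (((P.L : ℝ) ^ k) ^ 2)⁻¹ * curlAt (linAvgIter k a) x μ ν with hA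
  have hL0 : (0 : ℝ) < P.L := by exact_mod_cast P.L_pos
  have hLdpos : (0 : ℝ) < (P.L : ℝ) ^ (P.d + 2) := by positivity
  -- (1) the level-(k+1) pairing through the chain
  have hup : ∑ y : Site P (k + 1), (∑ r'' : Fin P.d → Fin P.L, Kk (Site.blockSite y r'')) *
        ((((P.L : ℝ) ^ (k + 1)) ^ 2)⁻¹ * curlAt (linAvgIter (k + 1) a) y μ ν) =
      ((P.L : ℝ) ^ (P.d + 2))⁻¹ * ∑ y : Site P (k + 1), ∑ r' : Fin P.d → Fin P.L, ∑ t : Fin P.L, ∑ s : Fin P.L,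
        (∑ r'' : Fin P.d → Fin P.L, Kk (Site.blockSite y r'')) * A (shiftN (shiftN (Site.blockSite y r') ν t) μ s) := by
    rw [Finset.mul_sum]
    refine Finset.sum_congr rfl fun y _ => ?_
    rw [mean_succ_eq]
    simp only [hA, Finset.mul_sum]
    refine Finset.sum_congr rfl fun r' _ => Finset.sum_congr rfl fun t _ => Finset.sum_congr rfl fun s _ => ?_
    ring
  -- (2) the level-k pairing, copied `L^(d+2)` times and reindexed through the bijections
  have hcopy : ∀ t s : Fin P.L, ∑ y : Site P (k + 1), ∑ r' : Fin P.d → Fin P.L,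
      (∑ _r'' : Fin P.d → Fin P.L, Kk (shiftN (shiftN (Site.blockSite y r') ν t) μ s)) * A (shiftN (shiftN (Site.blockSite y r') ν t) μ s) = ((P.L : ℝ) ^ P.d) * ∑ x : Site P k, Kk x * A x := by
    intro t s
    have h := sum_sum_shift_blockSite hk μ ν (t : ℕ) (s : ℕ) (fun x => Kk x * A x)
    have hc : ∀ (y : Site P (k + 1)) (r' : Fin P.d → Fin P.L),
        (∑ _r'' : Fin P.d → Fin P.L, Kk (shiftN (shiftN (Site.blockSite y r') ν t) μ s)) * A (shiftN (shiftN (Site.blockSite y r') ν t) μ s) = ((P.L : ℝ) ^ P.d) * (Kk (shiftN (shiftN (Site.blockSite y r') ν t) μ s) * A (shiftN (shiftN (Site.blockSite y r') ν t) μ s)) := by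
      intro y r'
      simp only [Finset.sum_const, Finset.card_univ, Fintype.card_fun, Fintype.card_fin, nsmul_eq_mul]
      push_cast; ring
    simp_rw [hc]
    simp only [← Finset.mul_sum]
    rw [h]
  have hdown : ∑ x : Site P k, Kk x * A x =
      ((P.L : ℝ) ^ (P.d + 2))⁻¹ * ∑ y : Site P (k + 1), ∑ r' : Fin P.d → Fin P.L, ∑ t : Fin P.L, ∑ s : Fin P.L,
        (∑ r'' : Fin P.d → Fin P.L, Kk (shiftN (shiftN (Site.blockSite y r') ν t) μ s)) * A (shiftN (shiftN (Site.blockSite y r') ν t) μ s) := by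
    rw [sum_four_comm (fun (y : Site P (k + 1)) (r' : Fin P.d → Fin P.L) (t : Fin P.L) (s : Fin P.L) =>
      (∑ r'' : Fin P.d → Fin P.L, Kk (shiftN (shiftN (Site.blockSite y r') ν t) μ s)) * A (shiftN (shiftN (Site.blockSite y r') ν t) μ s))]
    simp_rw [hcopy]
    simp only [Finset.sum_const, Finset.card_univ, Fintype.card_fin, nsmul_eq_mul]
    rw [pow_add]
    field_simp
  rw [hup, hdown, ← mul_sub, ← Finset.sum_sub_distrib]
  simp_rw [← Finset.sum_sub_distrib, ← sub_mul, ← Finset.sum_sub_distrib]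
  -- (3) bound each difference of masses by `ω`, then reindex the bound back to `T^(k)`
  have hterm : ∀ (y : Site P (k + 1)) (r' : Fin P.d → Fin P.L) (t s : Fin P.L),
      |(∑ r'' : Fin P.d → Fin P.L, (Kk (Site.blockSite y r'') - Kk (shiftN (shiftN (Site.blockSite y r') ν t) μ s))) * A (shiftN (shiftN (Site.blockSite y r') ν t) μ s)| ≤
        ((P.L : ℝ) ^ P.d) * (ω (shiftN (shiftN (Site.blockSite y r') ν t) μ s) * |A (shiftN (shiftN (Site.blockSite y r') ν t) μ s)|) := by
    intro y r' t s
    rw [abs_mul]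
    have h1 : |∑ r'' : Fin P.d → Fin P.L, (Kk (Site.blockSite y r'') - Kk (shiftN (shiftN (Site.blockSite y r') ν t) μ s))| ≤ ((P.L : ℝ) ^ P.d) * ω (shiftN (shiftN (Site.blockSite y r') ν t) μ s) := by
      refine (Finset.abs_sum_le_sum_abs _ _).trans ?_
      calc ∑ r'' : Fin P.d → Fin P.L, |Kk (Site.blockSite y r'') - Kk (shiftN (shiftN (Site.blockSite y r') ν t) μ s)|
          ≤ ∑ _r'' : Fin P.d → Fin P.L, ω (shiftN (shiftN (Site.blockSite y r') ν t) μ s) := Finset.sum_le_sum fun r'' _ => hω y r' r'' t s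
        _ = ((P.L : ℝ) ^ P.d) * ω (shiftN (shiftN (Site.blockSite y r') ν t) μ s) := by
          rw [Finset.sum_const, Finset.card_univ, Fintype.card_fun, Fintype.card_fin, Fintype.card_fin, nsmul_eq_mul]; push_cast; ring
    calc |∑ r'' : Fin P.d → Fin P.L, (Kk (Site.blockSite y r'') - Kk (shiftN (shiftN (Site.blockSite y r') ν t) μ s))| * |A (shiftN (shiftN (Site.blockSite y r') ν t) μ s)|
        ≤ ((P.L : ℝ) ^ P.d) * ω (shiftN (shiftN (Site.blockSite y r') ν t) μ s) * |A (shiftN (shiftN (Site.blockSite y r') ν t) μ s)| := mul_le_mul_of_nonneg_right h1 (abs_nonneg _)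
      _ = ((P.L : ℝ) ^ P.d) * (ω (shiftN (shiftN (Site.blockSite y r') ν t) μ s) * |A (shiftN (shiftN (Site.blockSite y r') ν t) μ s)|) := by ring
  have hre : ∀ t s : Fin P.L, ∑ y : Site P (k + 1), ∑ r' : Fin P.d → Fin P.L, ((P.L : ℝ) ^ P.d) * (ω (shiftN (shiftN (Site.blockSite y r') ν t) μ s) * |A (shiftN (shiftN (Site.blockSite y r') ν t) μ s)|) =
      ((P.L : ℝ) ^ P.d) * ∑ x : Site P k, ω x * |A x| := by
    intro t s
    simp only [← Finset.mul_sum]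
    rw [sum_sum_shift_blockSite hk μ ν (t : ℕ) (s : ℕ) (fun x => ω x * |A x|)]
  have hsum : |∑ y : Site P (k + 1), ∑ r' : Fin P.d → Fin P.L, ∑ t : Fin P.L, ∑ s : Fin P.L,
      (∑ r'' : Fin P.d → Fin P.L, (Kk (Site.blockSite y r'') - Kk (shiftN (shiftN (Site.blockSite y r') ν t) μ s))) * A (shiftN (shiftN (Site.blockSite y r') ν t) μ s)| ≤
      ∑ t : Fin P.L, ∑ s : Fin P.L, (((P.L : ℝ) ^ P.d) * ∑ x : Site P k, ω x * |A x|) := by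
    calc _ ≤ ∑ y : Site P (k + 1), ∑ r' : Fin P.d → Fin P.L, ∑ t : Fin P.L, ∑ s : Fin P.L,
          ((P.L : ℝ) ^ P.d) * (ω (shiftN (shiftN (Site.blockSite y r') ν t) μ s) * |A (shiftN (shiftN (Site.blockSite y r') ν t) μ s)|) := by
          refine (Finset.abs_sum_le_sum_abs _ _).trans (Finset.sum_le_sum fun y _ => ?_)
          refine (Finset.abs_sum_le_sum_abs _ _).trans (Finset.sum_le_sum fun r' _ => ?_)
          refine (Finset.abs_sum_le_sum_abs _ _).trans (Finset.sum_le_sum fun t _ => ?_)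
          exact (Finset.abs_sum_le_sum_abs _ _).trans (Finset.sum_le_sum fun s _ => hterm y r' t s)
      _ = ∑ t : Fin P.L, ∑ s : Fin P.L, (((P.L : ℝ) ^ P.d) * ∑ x : Site P k, ω x * |A x|) := by
          rw [sum_four_comm (fun (y : Site P (k + 1)) (r' : Fin P.d → Fin P.L) (t : Fin P.L) (s : Fin P.L) =>
            ((P.L : ℝ) ^ P.d) * (ω (shiftN (shiftN (Site.blockSite y r') ν t) μ s) * |A (shiftN (shiftN (Site.blockSite y r') ν t) μ s)|))]
          simp_rw [hre]
  rw [abs_mul, abs_inv, abs_of_pos hLdpos]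
  calc ((P.L : ℝ) ^ (P.d + 2))⁻¹ * |∑ y : Site P (k + 1), ∑ r' : Fin P.d → Fin P.L, ∑ t : Fin P.L, ∑ s : Fin P.L,
        (∑ r'' : Fin P.d → Fin P.L, (Kk (Site.blockSite y r'') - Kk (shiftN (shiftN (Site.blockSite y r') ν t) μ s))) * A (shiftN (shiftN (Site.blockSite y r') ν t) μ s)|
      ≤ ((P.L : ℝ) ^ (P.d + 2))⁻¹ * ∑ _t : Fin P.L, ∑ _s : Fin P.L, (((P.L : ℝ) ^ P.d) * ∑ x : Site P k, ω x * |A x|) :=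
        mul_le_mul_of_nonneg_left hsum (by positivity)
    _ = ∑ x : Site P k, ω x * |A x| := by
        simp only [Finset.sum_const, Finset.card_univ, Fintype.card_fin, nsmul_eq_mul]
        rw [pow_add]
        field_simp

/-- ★★ **THE TELESCOPE OVER THE LEVELS (sharp last term).**  Level masses `Km` with `K (m+1) Y′ = Σ_{r″} K m (blockSite Y′ r″)`, oscillation
bounds `ω m` as in `abs_pairing_succ_sub_pairing_le` at every level `m < i` (`i ≤ m + K`): then the level-0 pairing of `K 0` against the fine curl obeys
`|Σ_y K 0 y·curlAt a y μ ν| ≤ Σ_{m<i} Σ_Y ω m Y·|A_m(Y)| + |Σ_{Y′} K i Y′·A_i(Y′)|`, `A_m(Y) = (L^m)^{−2} curlAt (linAvgIter m a) Y μ ν`. [folklore] -/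
theorem abs_pairing_zero_le_telescope (a : PBond P 0 → ℝ) (μ ν : Fin P.d) (Km ω : (m : ℕ) → Site P m → ℝ)
    (hK : ∀ (m : ℕ) (y : Site P (m + 1)), m + 1 ≤ P.m + P.K → Km (m + 1) y = ∑ r'' : Fin P.d → Fin P.L, Km m (Site.blockSite y r''))
    (hω : ∀ (m : ℕ), m + 1 ≤ P.m + P.K → ∀ (y : Site P (m + 1)) (r' r'' : Fin P.d → Fin P.L) (t s : Fin P.L),
      |Km m (Site.blockSite y r'') - Km m (shiftN (shiftN (Site.blockSite y r') ν t) μ s)| ≤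
        ω m (shiftN (shiftN (Site.blockSite y r') ν t) μ s)) :
    ∀ i : ℕ, i ≤ P.m + P.K →
      |∑ y : Site P 0, Km 0 y * curlAt a y μ ν| ≤
        ∑ m ∈ Finset.range i, ∑ x : Site P m, ω m x * |(((P.L : ℝ) ^ m) ^ 2)⁻¹ * curlAt (linAvgIter m a) x μ ν| +
          |∑ y : Site P i, Km i y * ((((P.L : ℝ) ^ i) ^ 2)⁻¹ * curlAt (linAvgIter i a) y μ ν)|
  | 0, _ => by
    have h0 : ∀ y : Site P 0, Km 0 y * ((((P.L : ℝ) ^ 0) ^ 2)⁻¹ * curlAt (linAvgIter 0 a) y μ ν) = Km 0 y * curlAt a y μ ν := by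
      intro y
      simp only [pow_zero, one_pow, inv_one, one_mul]
      rfl
    simp only [Finset.range_zero, Finset.sum_empty, zero_add, h0, le_refl]
  | i + 1, hi => by
    have hi' : i ≤ P.m + P.K := Nat.le_of_succ_le hi
    have ih := abs_pairing_zero_le_telescope a μ ν Km ω hK hω i hi'
    have hstep := abs_pairing_succ_sub_pairing_le hi a μ ν (Km i) (ω i) (hω i hi)
    have hK' : ∑ y : Site P (i + 1), Km (i + 1) y * ((((P.L : ℝ) ^ (i + 1)) ^ 2)⁻¹ * curlAt (linAvgIter (i + 1) a) y μ ν) =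
        ∑ y : Site P (i + 1), (∑ r'' : Fin P.d → Fin P.L, Km i (Site.blockSite y r'')) *
          ((((P.L : ℝ) ^ (i + 1)) ^ 2)⁻¹ * curlAt (linAvgIter (i + 1) a) y μ ν) :=
      Finset.sum_congr rfl fun y _ => by rw [hK i y hi]
    rw [Finset.sum_range_succ, hK']
    -- `|P_i| ≤ |P_{i+1}| + |P_{i+1} − P_i|`
    have htri := abs_sub_abs_le_abs_sub
      (∑ x : Site P i, Km i x * ((((P.L : ℝ) ^ i) ^ 2)⁻¹ * curlAt (linAvgIter i a) x μ ν))
      (∑ y : Site P (i + 1), (∑ r'' : Fin P.d → Fin P.L, Km i (Site.blockSite y r'')) *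
          ((((P.L : ℝ) ^ (i + 1)) ^ 2)⁻¹ * curlAt (linAvgIter (i + 1) a) y μ ν))
    rw [abs_sub_comm] at htri
    linarith

/-- ★★ **THE TELESCOPE, CRUDE TOP** (the shape the kernel estimate feeds): `… ≤ Σ_{m<i} Σ_Y ω m Y·|A_m(Y)| + Σ_{Y′} |K i Y′|·|A_i(Y′)|`. [folklore] -/
theorem abs_pairing_zero_le_telescope' (a : PBond P 0 → ℝ) (μ ν : Fin P.d) (Km ω : (m : ℕ) → Site P m → ℝ)
    (hK : ∀ (m : ℕ) (y : Site P (m + 1)), m + 1 ≤ P.m + P.K → Km (m + 1) y = ∑ r'' : Fin P.d → Fin P.L, Km m (Site.blockSite y r''))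
    (hω : ∀ (m : ℕ), m + 1 ≤ P.m + P.K → ∀ (y : Site P (m + 1)) (r' r'' : Fin P.d → Fin P.L) (t s : Fin P.L),
      |Km m (Site.blockSite y r'') - Km m (shiftN (shiftN (Site.blockSite y r') ν t) μ s)| ≤
        ω m (shiftN (shiftN (Site.blockSite y r') ν t) μ s))
    (i : ℕ) (hi : i ≤ P.m + P.K) :
    |∑ y : Site P 0, Km 0 y * curlAt a y μ ν| ≤
      ∑ m ∈ Finset.range i, ∑ x : Site P m, ω m x * |(((P.L : ℝ) ^ m) ^ 2)⁻¹ * curlAt (linAvgIter m a) x μ ν| +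
        ∑ y : Site P i, |Km i y| * |(((P.L : ℝ) ^ i) ^ 2)⁻¹ * curlAt (linAvgIter i a) y μ ν| := by
  refine (abs_pairing_zero_le_telescope a μ ν Km ω hK hω i hi).trans (add_le_add le_rfl ?_)
  refine (Finset.abs_sum_le_sum_abs _ _).trans (Finset.sum_le_sum fun y _ => ?_)
  rw [abs_mul]

end Summit.QuantumFields.YangMills.Theorems.PoincareLipschitzLinAvgCurlMeanRecursion

end
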